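/-
Copyright: the b2b-balaban cell (near-miss cell 7), T⁴-continuum fan-out; row NE7b S4c (carrier debt F-ne7bp1g22-1(c) of
the COUNT route), part 3c, seat `t4-ne7b-formalise-leaf-02`.  Released under the licence of the surrounding project.
-/
import Summits.QuantumFields.BalabanUV.T4Continuum.Support.HistoryBankingLE

/-!
# Row NE7b S4c, part 3c: a `ConsistentTLE` chronological tagged genealogy IS a canonical branching record

Summits-side support leaf of the T⁴-continuum cell (rung (B)+1 on a FINITE torus only; NOT infinite volume, NOT the
mass gap, NOT the Clay statement; NOT a proof of the spine estimate NE7b).  Row NE7b, route «COUNT», claim-table row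
S4c (owner's ruling R-OWNER-22-6 (ii): «`canonFam` membership of the shape under `ConsistentTLE` + `Chrono` with the
renewal clause EXPLICIT»).  [folklore] bookkeeping over the lineage's OWN typed carrier
(`T4CanonicalMenus.{Chrono, maxStep, fuel, canonFam, menuRen, menuMer}`, `T4BranchingRecordsGas.{fam, relabel, shape,
bliveSlots, boldSlots}`, `HistoryBankingLE.ConsistentTLE`); nothing is quoted from print, nothing printed is asserted,
NO definition in this file, no `[cite:]` tag.

WHY.  `T4CanonicalMenus.mem_fam_of_chrono` dates a renewal inside `(rootStep, T]` and above its line's events through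
`ConsistentT`'s clause `h + 1 = reach` (`consistentT_rootStep_lt_reach`, `consistentT_maxStep_lt_reach`) and DISCARDS
the renewal clauses of `Chrono` («recorded strictly after its line's root birth and no earlier than any event already on
the line»), which say the same.  Under `ConsistentTLE` (renewal at `h + 1 ≤ reach`) the two dating facts are READ FROM
`Chrono` instead; births and mergers are unchanged.  So the socket's slot-membership obligation
`relabel (shape ∘ sh) G′ ∈ canonFam Dcap Ncap K G′.rootStep` holds for `ConsistentTLE` members exactly as for
`ConsistentT` ones.

WHAT.  §1 `consistentTLE_maxStep_le`, `consistentTLE_rootStep_le`.  §2 **`mem_fam_of_chronoLE`**,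
**`mem_canonFam_of_chronoLE`**, `mem_bliveSlots_of_chronoLE`, `mem_boldSlots_of_chronoLE` — the statements of
`T4CanonicalMenus.mem_fam_of_chrono` ∕ `mem_canonFam_of_chrono` ∕ `mem_bliveSlots_of_chrono` ∕ `mem_boldSlots_of_chrono`
with `ConsistentT` replaced by `ConsistentTLE`.  §3 Sanity: the early renewal `HistoryBankingLE.Sanity.early` is
chronological and its shape is a canonical record.

HONEST.  NE7b NOT proved; spine 0/9.  HONEST DEPENDENCY (cell): continuum YM on T⁴ ⇐ BetaPertH ∧ nine spine
estimates (0/9 proved); BetaPertH ⇐ (D1) ∧ (D4) ∧ CAP+tail.  This file changes none of it.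
-/

open Finset
open Literature.MathematicalPhysics.QuantumFieldTheory.Balaban1983to89
open T4PersistenceDictionary T4PrintedShapeBanking T4BankedInduction T4BranchingRecordsGas T4TaggedShapeBanking
open T4CanonicalMenus
open Summit.QuantumFields.BalabanUV.T4Continuum.HistoryBankingLE

namespace Summit.QuantumFields.BalabanUV.T4Continuum.HistoryCanonLE

/-! ## §1 Steps of a `ConsistentTLE` genealogy are performed steps -/

section Steps

variable {ε : Type*} {sh : ε → PEv} {C : T4PrintedShapeBanking.Consts} {K : ℕ} {R : ℕ → ℕ}

/-- all events of a `ConsistentTLE` genealogy happen at steps `≤ K` [folklore] -/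
theorem consistentTLE_maxStep_le : ∀ {G : Gen ε}, ConsistentTLE sh C K R G → maxStep (PEv.step ∘ sh) G ≤ K
  | Gen.born b j, hc => by
      simp only [ConsistentTLE] at hc
      obtain ⟨-, hs, hj⟩ := hc
      simpa [hs] using hj
  | Gen.renew G e h, hc => by
      simp only [ConsistentTLE] at hc
      obtain ⟨hG, -, hs, -, hK⟩ := hc
      have ih := consistentTLE_maxStep_le hG
      simp only [maxStep_renew, Function.comp_apply, hs]
      exact max_le ih hK
  | Gen.merge X Y e, hc => by
      simp only [ConsistentTLE] at hc
      obtain ⟨hX, hY, -, -, -, -, -, hK⟩ := hc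
      have ihX := consistentTLE_maxStep_le hX
      have ihY := consistentTLE_maxStep_le hY
      simp only [maxStep_merge, Function.comp_apply]
      exact max_le (max_le ihX ihY) hK

/-- a `ConsistentTLE` genealogy is born at a step `≤ K` [folklore] -/
theorem consistentTLE_rootStep_le : ∀ {G : Gen ε}, ConsistentTLE sh C K R G → G.rootStep ≤ K
  | Gen.born b j, hc => by simp only [ConsistentTLE] at hc; simpa using hc.2.2
  | Gen.renew G e h, hc => by
      simp only [ConsistentTLE] at hc
      simpa using consistentTLE_rootStep_le hc.1
  | Gen.merge X Y e, hc => by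
      simp only [ConsistentTLE] at hc
      simpa using Or.inl (consistentTLE_rootStep_le hc.1)

end Steps

/-! ## §2 `ConsistentTLE` + `Chrono` within the caps ⇒ a canonical branching record -/

section Canon

variable {ε : Type*} [DecidableEq ε] {sh : ε → PEv} {C : T4PrintedShapeBanking.Consts} {K : ℕ} {R : ℕ → ℕ}

/-- **A `ConsistentTLE` CHRONOLOGICAL TAGGED GENEALOGY WITHIN THE CLASS CAP IS A CANONICAL BRANCHING RECORD** of its own
fuel, main line born at its root step, events `≤ T` for any `T ≥` its latest step (= `T4CanonicalMenus.mem_fam_of_chrono`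
with `ConsistentT` ↦ `ConsistentTLE`; the renewal is dated by `Chrono`'s clauses `rootStep < st e`, `maxStep ≤ st e`
instead of by `h + 1 = reach`). [folklore] -/
theorem mem_fam_of_chronoLE (Dcap : ℕ → ℕ) :
    ∀ {G : Gen ε}, ConsistentTLE sh C K R G → Chrono (PEv.step ∘ sh) G →
      (∀ e ∈ G.events, (sh e).kind = 0 → (sh e).fat < Dcap K) → ∀ {T : ℕ}, maxStep (PEv.step ∘ sh) G ≤ T →
      relabel (shape ∘ sh) G ∈ fam menuRen menuMer (dictB Dcap K) (fuel G) (dictB Dcap K G.rootStep) G.rootStep T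
  | Gen.born b j, hc, _, hfat, T, _ => by
      simp only [ConsistentTLE] at hc
      obtain ⟨hk, hs, -⟩ := hc
      simp only [relabel_born, fuel_born, Gen.rootStep_born, Function.comp_apply]
      refine born_mem_fam ?_
      rw [← hs]
      exact shape_mem_dictB hk (hfat b (by simp) hk)
  | Gen.renew G e h, hc, hch, hfat, T, hT => by
      simp only [ConsistentTLE] at hc
      obtain ⟨hG, hk, hs, -, -⟩ := hc
      obtain ⟨hchG, hlt, hmx⟩ := hch
      simp only [Function.comp_apply, hs] at hlt hmx
      have ih := mem_fam_of_chronoLE Dcap hG hchG (fun e' he' => hfat e' (by simp [he'])) (T := h + 1) hmx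
      simp only [maxStep_renew, Function.comp_apply, hs] at hT
      simp only [relabel_renew, fuel_renew, Gen.rootStep_renew, Function.comp_apply]
      have hmem := renew_mem_fam (Lren := menuRen) (Lmer := menuMer) (Lpart := dictB Dcap K) (t := h + 1) (K := T)
        (e := shape (sh e)) (Finset.mem_Ioc.2 ⟨hlt, le_of_max_le_right hT⟩)
        (by rw [shape_of_kind1 hk, hs]; simp) ih
      simpa using hmem
  | Gen.merge X Y e, hc, hch, hfat, T, hT => by
      simp only [ConsistentTLE] at hc
      obtain ⟨hX, hY, hk, -, -, hy, -, -⟩ := hc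
      obtain ⟨hchX, hchY, hXY, hlt, hmX, hmY⟩ := hch
      have ihX := mem_fam_of_chronoLE Dcap hX hchX (fun e' he' => hfat e' (by simp [he'])) hmX
      have ihY := mem_fam_of_chronoLE Dcap hY hchY (fun e' he' => hfat e' (by simp [he'])) hmY
      simp only [maxStep_merge, Function.comp_apply] at hT
      simp only [Function.comp_apply] at hlt
      simp only [relabel_merge, fuel_merge, Gen.rootStep_merge, min_eq_left hXY, Function.comp_apply]
      exact merge_mem_fam (t := (sh e).step) (Finset.mem_Ioc.2 ⟨hlt, le_of_max_le_right hT⟩)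
        (by rw [shape_of_kind2 hk]; simp) (s' := Y.rootStep) (Finset.mem_Icc.2 ⟨hXY, hy⟩)
        (fam_mono (le_max_left _ _) _ _ _ ihX) (fam_mono (le_max_right _ _) _ _ _ ihY)

/-- **… HENCE A RECORD OF THE CANONICAL RUN AT CUTOFF `K`** whenever its fuel is within the run's:
`relabel (shape ∘ sh) G ∈ canonFam Dcap Ncap K G.rootStep`. [folklore] -/
theorem mem_canonFam_of_chronoLE {Dcap Ncap : ℕ → ℕ} {G : Gen ε} (hc : ConsistentTLE sh C K R G)
    (hch : Chrono (PEv.step ∘ sh) G) (hfat : ∀ e ∈ G.events, (sh e).kind = 0 → (sh e).fat < Dcap K)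
    (hn : fuel G ≤ Ncap K) : relabel (shape ∘ sh) G ∈ canonFam Dcap Ncap K G.rootStep :=
  fam_mono hn _ _ _ (mem_fam_of_chronoLE Dcap hc hch hfat (consistentTLE_maxStep_le hc))

/-- **… AND ITS BRANCHING SLOT IS LIVE**: `⟨G.rootStep, z, relabel (shape ∘ sh) G⟩ ∈ bliveSlots Cell (canonFam Dcap Ncap)
K` for every cell `z` of age `K − G.rootStep`. [folklore] -/
theorem mem_bliveSlots_of_chronoLE {γ : Type*} (Cell : ℕ → ℕ → Finset γ) {Dcap Ncap : ℕ → ℕ} {G : Gen ε}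
    (hc : ConsistentTLE sh C K R G) (hch : Chrono (PEv.step ∘ sh) G)
    (hfat : ∀ e ∈ G.events, (sh e).kind = 0 → (sh e).fat < Dcap K) (hn : fuel G ≤ Ncap K) {z : γ}
    (hz : z ∈ Cell K (K - G.rootStep)) :
    (⟨G.rootStep, z, relabel (shape ∘ sh) G⟩ : BSlot γ PEv) ∈ bliveSlots Cell (canonFam Dcap Ncap) K := by
  simp only [bliveSlots, Finset.mem_sigma, Finset.mem_range]
  exact ⟨Nat.lt_succ_of_le (consistentTLE_rootStep_le hc), hz, mem_canonFam_of_chronoLE hc hch hfat hn⟩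

/-- **… AND OLD when born before the cut `j⋆ K`**. [folklore] -/
theorem mem_boldSlots_of_chronoLE {γ : Type*} (Cell : ℕ → ℕ → Finset γ) {Dcap Ncap : ℕ → ℕ} (jstar : ℕ → ℕ)
    {G : Gen ε} (hc : ConsistentTLE sh C K R G) (hch : Chrono (PEv.step ∘ sh) G)
    (hfat : ∀ e ∈ G.events, (sh e).kind = 0 → (sh e).fat < Dcap K) (hn : fuel G ≤ Ncap K) {z : γ}
    (hz : z ∈ Cell K (K - G.rootStep)) (hold : G.rootStep < jstar K) :
    (⟨G.rootStep, z, relabel (shape ∘ sh) G⟩ : BSlot γ PEv) ∈ boldSlots Cell (canonFam Dcap Ncap) jstar K := by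
  simp only [boldSlots, Finset.mem_sigma, Finset.mem_range]
  exact ⟨hold, hz, mem_canonFam_of_chronoLE hc hch hfat hn⟩

end Canon

/-! ## §3 Sanity: the early renewal is a canonical record -/

namespace Sanity

open HistoryBankingLE.Sanity T4PrintedShapeBanking.XreadC4

/-- the early renewal of `HistoryBankingLE` §4 is chronological (renewal at step `3 > 0 = rootStep`, `≥` the birth
step) … [folklore] -/
theorem chrono_early : Chrono (PEv.step ∘ Prod.fst) early := by decide

/-- … so (class `8 < Dcap := 9`, fuel `2 ≤ Ncap := 2`) its shape is a record of the canonical run at every cutoff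
`K ≥ 3`. [folklore] -/
example {K : ℕ} (hK : 3 ≤ K) :
    relabel (shape ∘ Prod.fst) early ∈ canonFam (fun _ => 9) (fun _ => 2) K early.rootStep :=
  mem_canonFam_of_chronoLE (C := C₀) (R := fun _ => 2) (early_consistentTLE hK) chrono_early
    (fun e he _ => by
      simp only [early, Gen.events_renew, Gen.events_born, mem_insert, mem_singleton] at he
      rcases he with rfl | rfl <;> simp [PEv.fat])
    (by decide)

end Sanity

end Summit.QuantumFields.BalabanUV.T4Continuum.HistoryCanonLE
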